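import Summits.CriticalPhenomena.Ising3D.Control2DCellCheck2
import Summits.CriticalPhenomena.Ising3D.Control2DEps102Cuts2
import Summits.CriticalPhenomena.Ising3D.Control2DCertificateEps102
import HarnessLib

/-!
# The 2D control: obligation (C) of certificate `eps102` IN THE KERNEL (second-order scheme) — file G
(cell `pub-ising3x`, seat controls-1; kernel runs of `Control2DCellCheck2.checkSpin2`)

HONEST FRAMING: lottery ticket; floor = tightest certified 3D Ising CFT bounds; no exact-solution claim without a proof.

Kernel evaluations (`decide +kernel`; no `native_decide`, no extra axioms) of the second-order (C)
checker at `P = 80` on the data of certificate `eps102`, one per cut list of `Control2DEps102Cuts2.lean`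
(chunks `c2cuts6c`, `c2cuts8`, `c2cuts10`; estimated kernel time of this file ≈ 130 s).
-/

namespace Summit.CriticalPhenomena.Ising3D.Control2D.RB0

open Set
open Literature.MathematicalPhysics.QuantumFieldTheory.ConformalBootstrap3D
open Summit.CriticalPhenomena.Ising3D.Control2D

set_option maxHeartbeats 10000000 in
set_option maxRecDepth 200000 in
/-- (C) of `eps102`, spin `6`, cells of `eps102_c2cuts6c` (`80` cells, `N = 48`, depth `5`,
left stencil `103/16`, extra `97/4`). [folklore] -/
theorem eps102_check2_c2cuts6c :
    checkSpin2 80 48 6 (eps105_vals.map (NI.ofRat 80)) (mkCData 80 5 6 eps105_vals eps102_w eps1005_z eps1005_zb)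
      true (103/16) eps102_c2cuts6c (97/4) = true := by
  decide +kernel

set_option maxHeartbeats 10000000 in
set_option maxRecDepth 200000 in
/-- (C) of `eps102`, spin `8`, cells of `eps102_c2cuts8` (`70` cells, `N = 40`, depth `7`,
left stencil `none`, extra `97/4`). [folklore] -/
theorem eps102_check2_c2cuts8 :
    checkSpin2 80 40 8 (eps105_vals.map (NI.ofRat 80)) (mkCData 80 7 8 eps105_vals eps102_w eps1005_z eps1005_zb)
      false (0) eps102_c2cuts8 (97/4) = true := by
  decide +kernel

set_option maxHeartbeats 10000000 in
set_option maxRecDepth 200000 in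
/-- (C) of `eps102`, spin `10`, cells of `eps102_c2cuts10` (`63` cells, `N = 22`, depth `7`,
left stencil `none`, extra `97/4`). [folklore] -/
theorem eps102_check2_c2cuts10 :
    checkSpin2 80 22 10 (eps105_vals.map (NI.ofRat 80)) (mkCData 80 7 10 eps105_vals eps102_w eps1005_z eps1005_zb)
      false (0) eps102_c2cuts10 (97/4) = true := by
  decide +kernel

end Summit.CriticalPhenomena.Ising3D.Control2D.RB0
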